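import Mathlib
import Summits.Ventures.PercRepro2.Defs
import Summits.Ventures.PercRepro2.Graph
import Summits.Ventures.PercRepro2.OneColourSwitch
import Summits.Ventures.PercRepro2.RegionHubSign
import Summits.Ventures.PercRepro2.SideSwitch
import Summits.Ventures.PercRepro2.TermSwitchDefs
import Summits.Ventures.PercRepro2.TermSwitchReach
import Summits.Ventures.PercRepro2.M9NoPocketDefs
import Summits.Ventures.PercRepro2.M9LoopTransfer
import Summits.Ventures.PercRepro2.M9EdgeTransfer
import Summits.Ventures.PercRepro2.M9GammaSum
import Summits.Ventures.PercRepro2.M9LoopRS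
import Summits.Ventures.PercRepro2.M9GeneralDSplit
import Summits.Ventures.PercRepro2.M9FourParts
import Summits.Ventures.PercRepro2.M9ReachedK

/-!
# Loops at `d` and `r`–`s` edges are free for the reached sums (blind cell PercRepro2, p3 g37,
2026-08-29; `proofs/P3-POCKETRK.md` §7)

Two graph/colouring pairs with the same connections in both colours have the same worlds of
`{r, s}`, the same `Sep`, `DOne`, `σ`, the same worlds of any terminal set and the same `HD`
(the `connCongr_*` lemmas, §1).  Hence (i) moving a loop from `d` to `r` changes none of the sums
`reachedKSum`, `exSum`, `hdSum` (`reachedKSum_relocate_loop`, …); (ii) looping an `r`–`s` edge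
halves each of them (`reachedKSum_loop_rs`, `exSum_loop_rs`, `hdSum_loop_rs` — the pattern of
`dSignSum_loop_rs`, through the one generic lemma `sum_loop_rs_of_pred`).  The file
`M9NoPocketHygiene2` uses both to drop the hypotheses «no loop at `d`» and «no `r`–`s` edge» from
THEOREMS RK-NP and 2EXHD-NP.  Own work; std axioms.
-/

namespace Summit.Ventures.PercRepro2

namespace NoPocket

open Finset Classical RegionHub OneColourSwitch SideSwitch TermSwitch

variable {V : Type*} {E : Type*}

section Congr

variable {ends ends' : E → Sym2 V} {ω ω' : Config E}

/-- The congruence of the flipped colourings. -/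
lemma connCongr_compl
    (h : (∀ u v, Conn ends ω u v ↔ Conn ends' ω' u v) ∧
      (∀ u v, Conn ends (OneColourSwitch.compl ω) u v ↔
        Conn ends' (OneColourSwitch.compl ω') u v)) :
    (∀ u v, Conn ends (OneColourSwitch.compl ω) u v ↔
        Conn ends' (OneColourSwitch.compl ω') u v) ∧
      (∀ u v, Conn ends (OneColourSwitch.compl (OneColourSwitch.compl ω)) u v ↔
        Conn ends' (OneColourSwitch.compl (OneColourSwitch.compl ω')) u v) := by
  refine ⟨h.2, ?_⟩
  simp only [OneColourSwitch.compl_compl]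
  exact h.1

/-- The `Y`-world of `{r, s}` is determined by the connections. -/
lemma connCongr_K2_eq
    (h : (∀ u v, Conn ends ω u v ↔ Conn ends' ω' u v) ∧
      (∀ u v, Conn ends (OneColourSwitch.compl ω) u v ↔
        Conn ends' (OneColourSwitch.compl ω') u v)) (r s : V) :
    K2 ends r s ω = K2 ends' r s ω' := by
  ext x
  simp only [mem_K2_iff, h.1]

/-- The `W`-world of `{r, s}` is determined by the connections. -/
lemma connCongr_M2_eq
    (h : (∀ u v, Conn ends ω u v ↔ Conn ends' ω' u v) ∧
      (∀ u v, Conn ends (OneColourSwitch.compl ω) u v ↔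
        Conn ends' (OneColourSwitch.compl ω') u v)) (r s : V) :
    M2 ends r s ω = M2 ends' r s ω' := by
  ext x
  simp only [mem_M2_iff, h.2]

/-- `Sep` is determined by the connections. -/
lemma connCongr_sep2_iff
    (h : (∀ u v, Conn ends ω u v ↔ Conn ends' ω' u v) ∧
      (∀ u v, Conn ends (OneColourSwitch.compl ω) u v ↔
        Conn ends' (OneColourSwitch.compl ω') u v)) (p q r s : V) :
    sep2 ends p q r s ω ↔ sep2 ends' p q r s ω' := by
  simp only [sep2, sepY, h.1, h.2]

/-- `DOne` is determined by the connections. -/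
lemma connCongr_DOne_iff
    (h : (∀ u v, Conn ends ω u v ↔ Conn ends' ω' u v) ∧
      (∀ u v, Conn ends (OneColourSwitch.compl ω) u v ↔
        Conn ends' (OneColourSwitch.compl ω') u v)) (r s d : V) :
    DOne ends r s d ω ↔ DOne ends' r s d ω' := by
  simp only [DOne, connCongr_K2_eq h, connCongr_M2_eq h]

/-- `σ` is determined by the connections. -/
lemma connCongr_sigma_eq
    (h : (∀ u v, Conn ends ω u v ↔ Conn ends' ω' u v) ∧
      (∀ u v, Conn ends (OneColourSwitch.compl ω) u v ↔
        Conn ends' (OneColourSwitch.compl ω') u v)) (a b : V) :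
    sigma ends ω a b = sigma ends' ω' a b := by
  simp only [sigma, h.1, h.2]

/-- The `Y`-world of a terminal set is determined by the connections. -/
lemma connCongr_KH_eq
    (h : (∀ u v, Conn ends ω u v ↔ Conn ends' ω' u v) ∧
      (∀ u v, Conn ends (OneColourSwitch.compl ω) u v ↔
        Conn ends' (OneColourSwitch.compl ω') u v)) (H : Set V) :
    KH ends H ω = KH ends' H ω' := by
  ext x
  simp only [mem_KH_iff, h.1]

/-- The `W`-world of a terminal set is determined by the connections. -/
lemma connCongr_MH_eq
    (h : (∀ u v, Conn ends ω u v ↔ Conn ends' ω' u v) ∧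
      (∀ u v, Conn ends (OneColourSwitch.compl ω) u v ↔
        Conn ends' (OneColourSwitch.compl ω') u v)) (H : Set V) :
    MH ends H ω = MH ends' H ω' := by
  ext x
  simp only [mem_MH_iff, h.2]

/-- `Sep_H` is determined by the connections. -/
lemma connCongr_sepH_iff
    (h : (∀ u v, Conn ends ω u v ↔ Conn ends' ω' u v) ∧
      (∀ u v, Conn ends (OneColourSwitch.compl ω) u v ↔
        Conn ends' (OneColourSwitch.compl ω') u v)) (p q : V) (H : Set V) :
    sepH ends p q H ω ↔ sepH ends' p q H ω' := by
  simp only [sepH, connCongr_KH_eq h, connCongr_MH_eq h]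

/-- `DZero_H` is determined by the connections. -/
lemma connCongr_DZeroH_iff
    (h : (∀ u v, Conn ends ω u v ↔ Conn ends' ω' u v) ∧
      (∀ u v, Conn ends (OneColourSwitch.compl ω) u v ↔
        Conn ends' (OneColourSwitch.compl ω') u v)) (H : Set V) :
    DZeroH ends H ω ↔ DZeroH ends' H ω' := by
  simp only [DZeroH, connCongr_KH_eq h, connCongr_MH_eq h]

/-- `Reached` is determined by the connections. -/
lemma connCongr_Reached_iff
    (h : (∀ u v, Conn ends ω u v ↔ Conn ends' ω' u v) ∧
      (∀ u v, Conn ends (OneColourSwitch.compl ω) u v ↔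
        Conn ends' (OneColourSwitch.compl ω') u v)) (r s d : V) :
    Reached ends r s d ω ↔ Reached ends' r s d ω' := by
  simp only [Reached, connCongr_K2_eq h, connCongr_M2_eq h]

/-- `HD` is determined by the connections. -/
lemma connCongr_HD_iff
    (h : (∀ u v, Conn ends ω u v ↔ Conn ends' ω' u v) ∧
      (∀ u v, Conn ends (OneColourSwitch.compl ω) u v ↔
        Conn ends' (OneColourSwitch.compl ω') u v)) (p q r s d : V) :
    HD ends p q r s d ω ↔ HD ends' p q r s d ω' := by
  simp only [HD, connCongr_sep2_iff h, connCongr_DOne_iff h, connCongr_Reached_iff h,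
    connCongr_sepH_iff h, connCongr_DZeroH_iff h]

/-- The `K`-reached summand is determined by the connections. -/
lemma connCongr_termK_eq
    (h : (∀ u v, Conn ends ω u v ↔ Conn ends' ω' u v) ∧
      (∀ u v, Conn ends (OneColourSwitch.compl ω) u v ↔
        Conn ends' (OneColourSwitch.compl ω') u v)) (p q r s d : V) :
    (if sep2 ends p q r s ω ∧ DOne ends r s d ω ∧ d ∈ K2 ends r s ω then
        sigma ends ω p q * sigma ends ω r s else 0) =
      (if sep2 ends' p q r s ω' ∧ DOne ends' r s d ω' ∧ d ∈ K2 ends' r s ω' then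
        sigma ends' ω' p q * sigma ends' ω' r s else 0) := by
  simp only [connCongr_sep2_iff h, connCongr_DOne_iff h, connCongr_K2_eq h, connCongr_sigma_eq h]

/-- The doubly-reached summand is determined by the connections. -/
lemma connCongr_termEX_eq
    (h : (∀ u v, Conn ends ω u v ↔ Conn ends' ω' u v) ∧
      (∀ u v, Conn ends (OneColourSwitch.compl ω) u v ↔
        Conn ends' (OneColourSwitch.compl ω') u v)) (p q r s d : V) :
    (if sep2 ends p q r s ω ∧ DOne ends r s d ω ∧ (d ∈ K2 ends r s ω ∧ d ∈ M2 ends r s ω) then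
        sigma ends ω p q * sigma ends ω r s else 0) =
      (if sep2 ends' p q r s ω' ∧ DOne ends' r s d ω' ∧
          (d ∈ K2 ends' r s ω' ∧ d ∈ M2 ends' r s ω') then
        sigma ends' ω' p q * sigma ends' ω' r s else 0) := by
  simp only [connCongr_sep2_iff h, connCongr_DOne_iff h, connCongr_K2_eq h, connCongr_M2_eq h,
    connCongr_sigma_eq h]

/-- The hub–dead-end summand is determined by the connections. -/
lemma connCongr_termHD_eq
    (h : (∀ u v, Conn ends ω u v ↔ Conn ends' ω' u v) ∧
      (∀ u v, Conn ends (OneColourSwitch.compl ω) u v ↔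
        Conn ends' (OneColourSwitch.compl ω') u v)) (p q r s d : V) :
    (if HD ends p q r s d ω then sigma ends ω p q * sigma ends ω r s else 0) =
      (if HD ends' p q r s d ω' then sigma ends' ω' p q * sigma ends' ω' r s else 0) := by
  simp only [connCongr_HD_iff h, connCongr_sigma_eq h]

end Congr

section Loops

variable [DecidableEq E] {ends : E → Sym2 V}

/-- Relocating a loop: with `ends e` a loop, the graph with `e` a loop at `x` has the same
connections for every colouring. -/
lemma connCongr_update_loop {e : E} (hd : (ends e).IsDiag) (x : V) (ω : Config E) :
    (∀ u v, Conn ends ω u v ↔ Conn (Function.update ends e s(x, x)) ω u v) ∧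
      (∀ u v, Conn ends (OneColourSwitch.compl ω) u v ↔
        Conn (Function.update ends e s(x, x)) (OneColourSwitch.compl ω) u v) := by
  have key : ∀ ω' : Config E, ∀ u v, Conn ends ω' u v ↔
      Conn (Function.update ends e s(x, x)) ω' u v := by
    intro ω' u v
    constructor
    · refine conn_of_open_agree (fun e' he' hnd => ⟨?_, he'⟩)
      have hne : e' ≠ e := by rintro rfl; exact hnd hd
      rw [Function.update_of_ne hne]
    · refine conn_of_open_agree (fun e' he' hnd => ⟨?_, he'⟩)
      have hne : e' ≠ e := by
        rintro rfl
        apply hnd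
        simp only [Function.update_self, Sym2.mk_isDiag_iff]
      rw [Function.update_of_ne hne]
  exact ⟨key ω, key (OneColourSwitch.compl ω)⟩

/-- Recolouring a loop: the connections do not change (both colours). -/
lemma connCongr_recolour_loop {e : E} (hd : (ends e).IsDiag) (ω : Config E) (b : Bool) :
    (∀ u v, Conn ends ω u v ↔ Conn ends (Function.update ω e b) u v) ∧
      (∀ u v, Conn ends (OneColourSwitch.compl ω) u v ↔
        Conn ends (OneColourSwitch.compl (Function.update ω e b)) u v) := by
  refine ⟨fun u v => (M9Reduce.conn_update_loop_iff hd).symm, fun u v => ?_⟩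
  rw [M9Reduce.compl_update]
  exact (M9Reduce.conn_update_loop_iff hd).symm

end Loops

section Relocate

variable [Fintype V] [DecidableEq V] [Fintype E] [DecidableEq E] {ends : E → Sym2 V}
  {p q r s d : V}

omit [Fintype V] [DecidableEq V] in
/-- **Relocating a loop leaves the `K`-reached sum unchanged.** -/
theorem reachedKSum_relocate_loop {e : E} (hd : (ends e).IsDiag) (x : V) :
    reachedKSum ends p q r s d = reachedKSum (Function.update ends e s(x, x)) p q r s d := by
  unfold reachedKSum
  exact Finset.sum_congr rfl fun ω _ => connCongr_termK_eq (connCongr_update_loop hd x ω) p q r s d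

omit [Fintype V] [DecidableEq V] in
/-- **Relocating a loop leaves the doubly-reached sum unchanged.** -/
theorem exSum_relocate_loop {e : E} (hd : (ends e).IsDiag) (x : V) :
    exSum ends p q r s d = exSum (Function.update ends e s(x, x)) p q r s d := by
  unfold exSum
  exact Finset.sum_congr rfl fun ω _ => connCongr_termEX_eq (connCongr_update_loop hd x ω) p q r s d

omit [Fintype V] [DecidableEq V] in
/-- **Relocating a loop leaves the hub–dead-end sum unchanged.** -/
theorem hdSum_relocate_loop {e : E} (hd : (ends e).IsDiag) (x : V) :
    hdSum ends p q r s d = hdSum (Function.update ends e s(x, x)) p q r s d := by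
  unfold hdSum
  exact Finset.sum_congr rfl fun ω _ => connCongr_termHD_eq (connCongr_update_loop hd x ω) p q r s d

end Relocate

section LoopRS

variable [DecidableEq E] {ends : E → Sym2 V} {r s : V} {e : E}

/-- **The `Y`-world of `{r, s, d}` does not see an `r`–`s` edge.** -/
lemma KH_triple_loopRS (he : ends e = s(r, s)) (d : V) (ω : Config E) :
    KH ends ({r, s, d} : Set V) ω = KH (loopRS ends r e) ({r, s, d} : Set V) ω := by
  ext x
  rw [mem_KH_triple', mem_KH_triple', ← K2_loopRS he]
  cases h : ω e
  · rw [conn_iff_loopRS_of_closed (ends := ends) (r := r) (u := d) (v := x) h]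
  · rw [conn_iff_loopRS_of_open (ends := ends) he (u := d) (v := x) h]
    constructor
    · rintro (h1 | (h1 | ⟨_, h1⟩ | ⟨_, h1⟩))
      · exact Or.inl h1
      · exact Or.inr h1
      · exact Or.inl (by rw [K2_loopRS he, mem_K2_iff]; exact Or.inr h1)
      · exact Or.inl (by rw [K2_loopRS he, mem_K2_iff]; exact Or.inl h1)
    · rintro (h1 | h1)
      · exact Or.inl h1
      · exact Or.inr (Or.inl h1)

/-- **The `W`-world of `{r, s, d}` does not see an `r`–`s` edge.** -/
lemma MH_triple_loopRS (he : ends e = s(r, s)) (d : V) (ω : Config E) :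
    MH ends ({r, s, d} : Set V) ω = MH (loopRS ends r e) ({r, s, d} : Set V) ω :=
  KH_triple_loopRS he d (OneColourSwitch.compl ω)

/-- **`Reached` does not see an `r`–`s` edge.** -/
lemma Reached_loopRS (he : ends e = s(r, s)) (d : V) (ω : Config E) :
    Reached ends r s d ω ↔ Reached (loopRS ends r e) r s d ω := by
  simp only [Reached, K2_loopRS he, M2_loopRS he]

/-- **`HD` does not see an `r`–`s` edge.** -/
lemma HD_loopRS (he : ends e = s(r, s)) (p q d : V) (ω : Config E) :
    HD ends p q r s d ω ↔ HD (loopRS ends r e) p q r s d ω := by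
  simp only [HD, sep2_loopRS he, DOne_loopRS he, Reached_loopRS he, sepH, DZeroH,
    KH_triple_loopRS he, MH_triple_loopRS he]

end LoopRS

section Halving

variable [Fintype E] [DecidableEq E] {ends : E → Sym2 V} {p q r s : V} {e : E}

/-- **The generic halving lemma.**  For a predicate `P` on graph/colouring pairs that does not
see the edge `e` (it agrees with its value on the looped graph, and on the looped graph it does
not see the colour of `e`) and implies `Sep`, the sum `Σ_ω [P ω] σ_pq σ_rs` doubles when `e` is
looped. -/
theorem sum_loop_rs_of_pred (he : ends e = s(r, s)) (P : (E → Sym2 V) → Config E → Prop)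
    (hP : ∀ ω, P ends ω ↔ P (loopRS ends r e) ω)
    (hPu : ∀ ω b, P (loopRS ends r e) (Function.update ω e b) ↔ P (loopRS ends r e) ω)
    (hPsep : ∀ ω, P ends ω → sep2 ends p q r s ω) :
    2 * (∑ ω : Config E, if P ends ω then sigma ends ω p q * sigma ends ω r s else 0) =
      ∑ ω : Config E, if P (loopRS ends r e) ω then
        sigma (loopRS ends r e) ω p q * sigma (loopRS ends r e) ω r s else 0 := by
  set F : Config E → ℤ := fun ω => if P ends ω then sigma ends ω p q * sigma ends ω r s else 0
    with hF
  have hre : ∑ ω, F (flipEdge e ω) = ∑ ω, F ω := sum_flipEdge e F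
  have h2 : 2 * ∑ ω, F ω = ∑ ω, (F ω + F (flipEdge e ω)) := by
    rw [Finset.sum_add_distrib, hre]; ring
  rw [h2]
  refine Finset.sum_congr rfl fun ω _ => ?_
  simp only [hF, flipEdge_apply]
  have hPf : P ends ω ↔ P ends (Function.update ω e (!ω e)) := by
    rw [hP, hP, hPu]
  have hpq : sigma (loopRS ends r e) (Function.update ω e (!ω e)) p q =
      sigma (loopRS ends r e) ω p q := by
    unfold sigma
    simp only [M9Reduce.compl_update, conn_loopRS_update]
  by_cases hL : P ends ω
  · have hL' : P ends (Function.update ω e (!ω e)) := hPf.1 hL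
    have hLl : P (loopRS ends r e) ω := (hP ω).1 hL
    rw [if_pos hL, if_pos hL', if_pos hLl, sigma_pq_loopRS he (hPsep ω hL),
      sigma_pq_loopRS he (hPsep _ hL'), hpq, ← mul_add, sigma_rs_add_flip he]
  · have hL' : ¬ P ends (Function.update ω e (!ω e)) := fun h => hL (hPf.2 h)
    have hLl : ¬ P (loopRS ends r e) ω := fun h => hL ((hP ω).2 h)
    rw [if_neg hL, if_neg hL', if_neg hLl, add_zero]

variable {d : V}

omit [Fintype E] in
/-- The looped graph does not see the colour of `e`: the congruence of the recolouring. -/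
lemma connCongr_loopRS_update (ω : Config E) (b : Bool) :
    (∀ u v, Conn (loopRS ends r e) ω u v ↔
        Conn (loopRS ends r e) (Function.update ω e b) u v) ∧
      (∀ u v, Conn (loopRS ends r e) (OneColourSwitch.compl ω) u v ↔
        Conn (loopRS ends r e) (OneColourSwitch.compl (Function.update ω e b)) u v) :=
  connCongr_recolour_loop loopRS_isDiag ω b

/-- **Looping an `r`–`s` edge halves the `K`-reached sum.** -/
theorem reachedKSum_loop_rs (he : ends e = s(r, s)) :
    2 * reachedKSum ends p q r s d = reachedKSum (loopRS ends r e) p q r s d := by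
  have key := sum_loop_rs_of_pred (p := p) (q := q) he
    (fun en ω => sep2 en p q r s ω ∧ DOne en r s d ω ∧ d ∈ K2 en r s ω)
    (fun ω => by simp only [sep2_loopRS he, DOne_loopRS he, K2_loopRS he])
    (fun ω b => by
      have h := connCongr_loopRS_update (ends := ends) (r := r) (e := e) ω b
      simp only [connCongr_sep2_iff h p q r s, connCongr_DOne_iff h r s d, connCongr_K2_eq h r s])
    (fun ω h => h.1)
  unfold reachedKSum
  convert key using 3
  · split_ifs <;> rfl

/-- **Looping an `r`–`s` edge halves the doubly-reached sum.** -/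
theorem exSum_loop_rs (he : ends e = s(r, s)) :
    2 * exSum ends p q r s d = exSum (loopRS ends r e) p q r s d := by
  have key := sum_loop_rs_of_pred (p := p) (q := q) he
    (fun en ω => sep2 en p q r s ω ∧ DOne en r s d ω ∧ (d ∈ K2 en r s ω ∧ d ∈ M2 en r s ω))
    (fun ω => by simp only [sep2_loopRS he, DOne_loopRS he, K2_loopRS he, M2_loopRS he])
    (fun ω b => by
      have h := connCongr_loopRS_update (ends := ends) (r := r) (e := e) ω b
      simp only [connCongr_sep2_iff h p q r s, connCongr_DOne_iff h r s d, connCongr_K2_eq h r s,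
        connCongr_M2_eq h r s])
    (fun ω h => h.1)
  unfold exSum
  convert key using 3
  · split_ifs <;> rfl

/-- **Looping an `r`–`s` edge halves the hub–dead-end sum.** -/
theorem hdSum_loop_rs (he : ends e = s(r, s)) :
    2 * hdSum ends p q r s d = hdSum (loopRS ends r e) p q r s d := by
  have key := sum_loop_rs_of_pred (p := p) (q := q) he (fun en ω => HD en p q r s d ω)
    (fun ω => HD_loopRS he p q d ω)
    (fun ω b => (connCongr_HD_iff (connCongr_loopRS_update (ends := ends) (r := r) (e := e) ω b)
      p q r s d).symm)
    (fun ω h => h.1)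
  unfold hdSum
  convert key using 3

end Halving

end NoPocket

end Summit.Ventures.PercRepro2
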